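import Summits.KontsevichZagierPeriods.KontsevichZagierPeriods.Theses.HurwitzMicroSectors
import Summits.KontsevichZagierPeriods.KontsevichZagierPeriods.Theorems.HurwitzMicroSectorsNormalFormPrinciplePiBoxTransfer
import Summits.KontsevichZagierPeriods.KontsevichZagierPeriods.Theorems.HurwitzMicroSectorsNormalFormPrincipleVariants2238
import Summits.KontsevichZagierPeriods.KontsevichZagierPeriods.Theorems.HurwitzMicroSectorsNormalFormPrincipleVariants2349

/-! TTRL-lite variant V2222 of stmt-KontsevichZagierPeriods-3869

Variant V2222 = `stub_boxRigidity` (the leaf `BoxRigidity` of `NormalFormPrinciple`: two representations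
on open unit boxes with integrands of KZ's rational shape `p/q`, `p, q` over `ℚ`, and equal values are
KZ-equivalent) under the TWO-sided small-case move `fix_nat:m=2; bound_nat:m'≤5` (left dimension frozen
to `2`, right dimension `≤ 5`). Verdict of the attempt seat: **open** — this file is the exact-strength
certificate, not a proof of the variant. A joint bound on both dimensions is a genuine weakening of the
leaf (unlike the one-sided moves V2200/V2219/…/V2256, each the whole leaf), and it is worth exactly
`BoxVanishing D` for the LARGEST dimension `D` allowed (here `D = max 2 5 = 5`): writing `BoxVanishing K`
for "every box-rational representation on `(0,1)^K` of value `0` is a relation",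
* `V2222 ⟺ BoxVanishing 5` (`stub_boxRigidity_var2222_iff_boxVanishing_five`): (⇒) compare a vanishing
  `5`-dimensional representation with the zero representation on the `2`-box
  (`boxVanishingDim_right_of_pair`, file `…Variants2238`); (⇐) pad both representations to the `5`-box
  and subtract there (`boxRigidityLe_of_boxVanishingDim`, same file);
* hence `V2222 ⟺ BoxRigidity for all m, m' ≤ 5` (`stub_boxRigidity_var2222_iff_le_five`), and V2222
  gives `BoxVanishing j` for every `j ≤ 5` (`boxVanishing_le_five_of_stub_boxRigidity_var2222`), in
  particular the sibling V2238 (`= BoxVanishing 3`, `stub_boxRigidity_var2238_of_var2222`).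
Why open: V2222 contains, UNCONDITIONALLY, Conjecture 1 on every weight-`2` box sector
`P(xy)/(1 − (xy)^k)` (`sectorTwoLevel_of_stub_boxRigidity_var2222`; `k = 4` is verbatim the conclusion of
`CatalanSectorTwoFour` without its open hypothesis `Indep_ℚ(1, π², G)`:
`sectorTwoFour_of_stub_boxRigidity_var2222`) and on every weight-`5` box sector `P(t)/(1 − t^k)`,
`t = x₀x₁x₂x₃x₄` (`sectorFiveLevel_of_stub_boxRigidity_var2222`; `k = 1`: values in `ℚ + ℚζ(5)`, and for
the pair `[1/(1 − t)]` (value `ζ(5)`) versus a rational constant `[q]` the case split is `ζ(5) = q` — the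
rigidity input is the irrationality of `ζ(5)`, open). The tree closes such sectors only by
reduction–rigidity with a linear-independence THEOREM as input (Baker in dimension `1`:
`boxRigidity_of_le_one`; Apéry on the `(3,2)` sector; Calegari–Dimitrov–Tang on `(2,6)`), and no such
theorem exists in dimension `5`. Conversely `KontsevichZagierPeriods → V2222`
(`stub_boxRigidity_var2222_of_statement`), so a refutation of the variant would refute the Summit: the
variant is neither provable nor refutable from the tree.
Source: M. Kontsevich, D. Zagier, *Periods* (2001), §1.2 Conjecture 1. Pure proof file, no definitions. -/

-- `Summit.<Summit>.<Problem>` is the tree's mandated summit-side namespace (CONVENTIONS §2); for this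
-- single-conjunct summit the two coincide, so the duplicate is deliberate.
set_option linter.dupNamespace false

noncomputable section

namespace Summit.KontsevichZagierPeriods.KontsevichZagierPeriods.Theorems

open MeasureTheory Set
open Literature.NumberTheory.Transcendental Literature.NumberTheory.Transcendental.KZ
open Summit.KontsevichZagierPeriods.KontsevichZagierPeriods.Theses.HurwitzMicroSectors
open Summit.KontsevichZagierPeriods.HurwitzMicroSectors.NormalFormPrinciple.PiBox

/-! ## The variant V2222 itself: exactly `BoxVanishing 5` -/

/-- **V2222 ⟺ `BoxVanishing 5`**: (⇒) the pair of dimensions `(2, 5)` is allowed (`5 ≤ 5`), so a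
vanishing box-rational representation on `(0,1)⁵` is KZ-equivalent to the zero representation on the
`2`-box, itself a relation (`boxVanishingDim_right_of_pair 2 5`); (⇐) `boxRigidityLe_of_boxVanishingDim 5`
with `m = 2 ≤ 5`, `m' ≤ 5`. [cite: KontsevichZagier2001, §1.2 Conjecture 1] -/
theorem stub_boxRigidity_var2222_iff_boxVanishing_five :
    (∀ (m' : ℕ) (N : IntegralRep 2) (N' : IntegralRep m'), m' ≤ 5 → N.domain = {x | ∀ i, x i ∈ Set.Ioo (0:ℝ) 1} → N.IsRational → N'.domain = {x | ∀ i, x i ∈ Set.Ioo (0:ℝ) 1} → N'.IsRational → N.value = N'.value → Equivalent N N') ↔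
    (∀ (M : IntegralRep 5), M.domain = {x | ∀ i, x i ∈ Set.Ioo (0:ℝ) 1} → M.IsRational →
      M.value = 0 → of M ∈ relations) :=
  ⟨fun h => boxVanishingDim_right_of_pair 2 5 fun N N' => h 5 N N' le_rfl,
    fun hvan m' N N' hm' => boxRigidityLe_of_boxVanishingDim 5 hvan 2 m' N N' (by norm_num) hm'⟩

/-- **V2222 ⟺ `BoxRigidity` for all `m, m' ≤ 5`** (so V2222 coincides with the joint variant
`bound_nat:m≤5; bound_nat:m'≤5` and with every `fix/bound` sibling of maximum dimension `5`).
[cite: KontsevichZagier2001, §1.2 Conjecture 1] -/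
theorem stub_boxRigidity_var2222_iff_le_five :
    (∀ (m' : ℕ) (N : IntegralRep 2) (N' : IntegralRep m'), m' ≤ 5 → N.domain = {x | ∀ i, x i ∈ Set.Ioo (0:ℝ) 1} → N.IsRational → N'.domain = {x | ∀ i, x i ∈ Set.Ioo (0:ℝ) 1} → N'.IsRational → N.value = N'.value → Equivalent N N') ↔
    (∀ (m m' : ℕ) (N : IntegralRep m) (N' : IntegralRep m'), m ≤ 5 → m' ≤ 5 →
      N.domain = {x | ∀ i, x i ∈ Set.Ioo (0:ℝ) 1} → N.IsRational →
      N'.domain = {x | ∀ i, x i ∈ Set.Ioo (0:ℝ) 1} → N'.IsRational →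
      N.value = N'.value → Equivalent N N') := by
  rw [stub_boxRigidity_var2222_iff_boxVanishing_five]
  exact ⟨fun hvan => boxRigidityLe_of_boxVanishingDim 5 hvan,
    fun h => boxVanishingDim_left_of_pair 5 5 fun N N' => h 5 5 N N' le_rfl le_rfl⟩

/-- **V2222 ⇒ `BoxVanishing j` for every `j ≤ 5`** (monotonicity in the dimension: pad by unit
intervals). [cite: KontsevichZagier2001, §1.2 Conjecture 1] -/
theorem boxVanishing_le_five_of_stub_boxRigidity_var2222
    (h : ∀ (m' : ℕ) (N : IntegralRep 2) (N' : IntegralRep m'), m' ≤ 5 → N.domain = {x | ∀ i, x i ∈ Set.Ioo (0:ℝ) 1} → N.IsRational → N'.domain = {x | ∀ i, x i ∈ Set.Ioo (0:ℝ) 1} → N'.IsRational → N.value = N'.value → Equivalent N N')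
    {j : ℕ} (hj : j ≤ 5) (N : IntegralRep j) (hNd : N.domain = {x | ∀ i, x i ∈ Set.Ioo (0:ℝ) 1})
    (hNr : N.IsRational) (hv : N.value = 0) : of N ∈ relations :=
  boxVanishingDim_mono hj (stub_boxRigidity_var2222_iff_boxVanishing_five.1 h) N hNd hNr hv

/-- **V2222 ⇒ the sibling V2238** (`fix_nat:m=3; bound_nat:m'≤2`, which is `BoxVanishing 3`): the
two-sided variants are linearly ordered by their maximum dimension. [cite: KontsevichZagier2001, §1.2 Conjecture 1] -/
theorem stub_boxRigidity_var2238_of_var2222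
    (h : ∀ (m' : ℕ) (N : IntegralRep 2) (N' : IntegralRep m'), m' ≤ 5 → N.domain = {x | ∀ i, x i ∈ Set.Ioo (0:ℝ) 1} → N.IsRational → N'.domain = {x | ∀ i, x i ∈ Set.Ioo (0:ℝ) 1} → N'.IsRational → N.value = N'.value → Equivalent N N') :
    ∀ (m' : ℕ) (N : IntegralRep 3) (N' : IntegralRep m'), m' ≤ 2 → N.domain = {x | ∀ i, x i ∈ Set.Ioo (0:ℝ) 1} → N.IsRational → N'.domain = {x | ∀ i, x i ∈ Set.Ioo (0:ℝ) 1} → N'.IsRational → N.value = N'.value → Equivalent N N' :=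
  stub_boxRigidity_var2238_iff_boxVanishing_three.2 fun M hMd hMr hv =>
    boxVanishing_le_five_of_stub_boxRigidity_var2222 h (by norm_num) M hMd hMr hv

/-- **The parent leaf ⇒ V2222** (specialisation). [cite: KontsevichZagier2001, §1.2 Conjecture 1] -/
theorem stub_boxRigidity_var2222_of_parent
    (h : ∀ (m m' : ℕ) (N : IntegralRep m) (N' : IntegralRep m'), N.domain = {x | ∀ i, x i ∈ Set.Ioo (0:ℝ) 1} → N.IsRational → N'.domain = {x | ∀ i, x i ∈ Set.Ioo (0:ℝ) 1} → N'.IsRational → N.value = N'.value → Equivalent N N') :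
    ∀ (m' : ℕ) (N : IntegralRep 2) (N' : IntegralRep m'), m' ≤ 5 → N.domain = {x | ∀ i, x i ∈ Set.Ioo (0:ℝ) 1} → N.IsRational → N'.domain = {x | ∀ i, x i ∈ Set.Ioo (0:ℝ) 1} → N'.IsRational → N.value = N'.value → Equivalent N N' :=
  fun m' N N' _ => h 2 m' N N'

/-- **`KontsevichZagierPeriods ⇒ V2222`**: the variant is a special case of Conjecture 1 for the tree's
calculus (`leaves_of_statement`) — so a refutation of the variant would refute the Summit.
[cite: KontsevichZagier2001, §1.2 Conjecture 1] -/
theorem stub_boxRigidity_var2222_of_statement (h : _root_.KontsevichZagierPeriods) :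
    ∀ (m' : ℕ) (N : IntegralRep 2) (N' : IntegralRep m'), m' ≤ 5 → N.domain = {x | ∀ i, x i ∈ Set.Ioo (0:ℝ) 1} → N.IsRational → N'.domain = {x | ∀ i, x i ∈ Set.Ioo (0:ℝ) 1} → N'.IsRational → N.value = N'.value → Equivalent N N' :=
  stub_boxRigidity_var2222_of_parent (leaves_of_statement h).1

/-! ## What the variant contains unconditionally: the weight-two and weight-five box sectors -/

/-- **V2222 ⇒ Conjecture 1 on EVERY weight-`2` box sector `P(xy)/(1 − (xy)^k)`, unconditionally**
(`k ≠ 0`; values in the `ℚ`-span of `1` and the level-`k` Hurwitz values `ζ(2, j/k)`), whereas the tree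
closes such a sector only with a linear-independence theorem as rigidity input (`k = 6`:
Calegari–Dimitrov–Tang, a hypothesis of `SectorTwoSix`; `k = 4`: the open `Indep_ℚ(1, π², G)`).
[cite: KontsevichZagier2001, §1.2 Conjecture 1] -/
theorem sectorTwoLevel_of_stub_boxRigidity_var2222
    (h : ∀ (m' : ℕ) (N : IntegralRep 2) (N' : IntegralRep m'), m' ≤ 5 → N.domain = {x | ∀ i, x i ∈ Set.Ioo (0:ℝ) 1} → N.IsRational → N'.domain = {x | ∀ i, x i ∈ Set.Ioo (0:ℝ) 1} → N'.IsRational → N.value = N'.value → Equivalent N N')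
    (k : ℕ) (hk : k ≠ 0) :
    ∀ (r r' : IntegralRep 2) (P P' : Polynomial ℚ), r.domain = {x | ∀ i, x i ∈ Set.Ioo (0:ℝ) 1} → r'.domain = {x | ∀ i, x i ∈ Set.Ioo (0:ℝ) 1} → Set.EqOn r.integrand (fun x => Polynomial.aeval (x 0 * x 1) P / (1 - (x 0 * x 1) ^ k)) r.domain → Set.EqOn r'.integrand (fun x => Polynomial.aeval (x 0 * x 1) P' / (1 - (x 0 * x 1) ^ k)) r'.domain → r.value = r'.value → Equivalent r r' :=
  fun r r' P P' hrd hr'd hri hr'i hv =>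
    h 2 r r' (by norm_num) hrd (isRational_of_eqOn_sector k hk r P hrd hri)
      hr'd (isRational_of_eqOn_sector k hk r' P' hr'd hr'i) hv

/-- **V2222 ⇒ Conjecture 1 on the level-`4` weight-`2` box sector, unconditionally** — verbatim the
conclusion of `CatalanSectorTwoFour` (stmt-KontsevichZagierPeriods-3877) WITHOUT its hypothesis
`LinearIndependent ℚ ![1, π², G]` (irrationality of Catalan's constant and more: open).
[cite: KontsevichZagier2001, §1.2 Conjecture 1] -/
theorem sectorTwoFour_of_stub_boxRigidity_var2222
    (h : ∀ (m' : ℕ) (N : IntegralRep 2) (N' : IntegralRep m'), m' ≤ 5 → N.domain = {x | ∀ i, x i ∈ Set.Ioo (0:ℝ) 1} → N.IsRational → N'.domain = {x | ∀ i, x i ∈ Set.Ioo (0:ℝ) 1} → N'.IsRational → N.value = N'.value → Equivalent N N') :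
    ∀ (r r' : IntegralRep 2) (P P' : Polynomial ℚ), r.domain = {x | ∀ i, x i ∈ Set.Ioo (0:ℝ) 1} → r'.domain = {x | ∀ i, x i ∈ Set.Ioo (0:ℝ) 1} → Set.EqOn r.integrand (fun x => Polynomial.aeval (x 0 * x 1) P / (1 - (x 0 * x 1) ^ 4)) r.domain → Set.EqOn r'.integrand (fun x => Polynomial.aeval (x 0 * x 1) P' / (1 - (x 0 * x 1) ^ 4)) r'.domain → r.value = r'.value → Equivalent r r' :=
  sectorTwoLevel_of_stub_boxRigidity_var2222 h 4 (by norm_num)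

/-- A representation on the open unit `5`-box whose integrand is `P(t)/(1 − t^k)` on it,
`t = x₀x₁x₂x₃x₄` (`k ≠ 0`, `P ∈ ℚ[t]`), has KZ's rational shape: `p = P(X₀X₁X₂X₃X₄)`,
`q = 1 − (X₀X₁X₂X₃X₄)^k`, and `q > 0` on the box. [cite: KontsevichZagier2001, §1.1 Definition] -/
theorem isRational_of_eqOn_sectorFive (k : ℕ) (hk : k ≠ 0) (r : IntegralRep 5) (P : Polynomial ℚ)
    (hrd : r.domain = {x | ∀ i, x i ∈ Set.Ioo (0:ℝ) 1})
    (hri : Set.EqOn r.integrand (fun x => Polynomial.aeval (x 0 * x 1 * x 2 * x 3 * x 4) P /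
      (1 - (x 0 * x 1 * x 2 * x 3 * x 4) ^ k)) r.domain) :
    r.IsRational := by
  refine ⟨Polynomial.aeval (MvPolynomial.X 0 * MvPolynomial.X 1 * MvPolynomial.X 2 * MvPolynomial.X 3 *
      MvPolynomial.X 4 : MvPolynomial (Fin 5) ℚ) P,
    1 - (MvPolynomial.X 0 * MvPolynomial.X 1 * MvPolynomial.X 2 * MvPolynomial.X 3 * MvPolynomial.X 4) ^ k,
    fun x hx => ?_, fun x hx => ?_⟩
  · rw [hrd] at hx
    obtain ⟨h0p, h0l⟩ := hx 0
    obtain ⟨h1p, h1l⟩ := hx 1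
    obtain ⟨h2p, h2l⟩ := hx 2
    obtain ⟨h3p, h3l⟩ := hx 3
    obtain ⟨h4p, h4l⟩ := hx 4
    have h01 : x 0 * x 1 < 1 := mul_lt_one_of_nonneg_of_lt_one_left h0p.le h0l h1l.le
    have h012 : x 0 * x 1 * x 2 < 1 :=
      mul_lt_one_of_nonneg_of_lt_one_left (mul_pos h0p h1p).le h01 h2l.le
    have h0123 : x 0 * x 1 * x 2 * x 3 < 1 :=
      mul_lt_one_of_nonneg_of_lt_one_left (mul_pos (mul_pos h0p h1p) h2p).le h012 h3l.le
    have h01234 : x 0 * x 1 * x 2 * x 3 * x 4 < 1 :=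
      mul_lt_one_of_nonneg_of_lt_one_left (mul_pos (mul_pos (mul_pos h0p h1p) h2p) h3p).le h0123 h4l.le
    have hlt : (x 0 * x 1 * x 2 * x 3 * x 4) ^ k < 1 :=
      pow_lt_one₀ (mul_pos (mul_pos (mul_pos (mul_pos h0p h1p) h2p) h3p) h4p).le h01234 hk
    simp only [map_sub, map_one, map_pow, map_mul, MvPolynomial.aeval_X]
    exact (sub_pos.2 hlt).ne'
  · rw [hri hx]
    simp only [map_sub, map_one, map_pow, map_mul, MvPolynomial.aeval_X,
      ← Polynomial.aeval_algHom_apply]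

/-- **V2222 ⇒ Conjecture 1 on EVERY weight-`5` box sector `P(t)/(1 − t^k)`, `t = x₀x₁x₂x₃x₄`,
unconditionally** (`k ≠ 0`). For `k = 1` the values lie in `ℚ + ℚζ(5)`
(`∫_{(0,1)⁵} t^j/(1 − t) = ζ(5) − H_j^{(5)}`), so for the pair `[1/(1 − t)]` (value `ζ(5)`) and a rational
constant `[q]` the premise is `ζ(5) = q`: in the tree's only mechanism (reduction–rigidity) the rigidity
input of this instance is the irrationality of `ζ(5)` — open. This is the sharpest reason the seat
records V2222 as open rather than provable. [cite: KontsevichZagier2001, §1.2 Conjecture 1] -/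
theorem sectorFiveLevel_of_stub_boxRigidity_var2222
    (h : ∀ (m' : ℕ) (N : IntegralRep 2) (N' : IntegralRep m'), m' ≤ 5 → N.domain = {x | ∀ i, x i ∈ Set.Ioo (0:ℝ) 1} → N.IsRational → N'.domain = {x | ∀ i, x i ∈ Set.Ioo (0:ℝ) 1} → N'.IsRational → N.value = N'.value → Equivalent N N')
    (k : ℕ) (hk : k ≠ 0) :
    ∀ (r r' : IntegralRep 5) (P P' : Polynomial ℚ), r.domain = {x | ∀ i, x i ∈ Set.Ioo (0:ℝ) 1} →
      r'.domain = {x | ∀ i, x i ∈ Set.Ioo (0:ℝ) 1} →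
      Set.EqOn r.integrand (fun x => Polynomial.aeval (x 0 * x 1 * x 2 * x 3 * x 4) P /
        (1 - (x 0 * x 1 * x 2 * x 3 * x 4) ^ k)) r.domain →
      Set.EqOn r'.integrand (fun x => Polynomial.aeval (x 0 * x 1 * x 2 * x 3 * x 4) P' /
        (1 - (x 0 * x 1 * x 2 * x 3 * x 4) ^ k)) r'.domain →
      r.value = r'.value → Equivalent r r' :=
  fun r r' P P' hrd hr'd hri hr'i hv =>
    (stub_boxRigidity_var2222_iff_le_five.1 h) 5 5 r r' le_rfl le_rfl hrd
      (isRational_of_eqOn_sectorFive k hk r P hrd hri) hr'd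
      (isRational_of_eqOn_sectorFive k hk r' P' hr'd hr'i) hv

end Summit.KontsevichZagierPeriods.KontsevichZagierPeriods.Theorems

end
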